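import Summits.HubbardSuperconductivity.HubbardSuperconductivity.Theorems.AnisotropyChordKnnRatioCheck
import Summits.HubbardSuperconductivity.HubbardSuperconductivity.Theorems.AnisotropyChordKnnIsotropic

/-!
# Route `AnisotropyChord` / H0 rotor rung, K_{n,n} sibling of XY-LM₀: **`XYLiebMattisKnn n Δ` for every `n ≤ 32` on the
# WHOLE interval `0 ≤ Δ ≤ 1`** — the ratio-majorant checker at `η₀ = 1` (one rational evaluation per `(n, M)`, no
# certificate data) closes the perturbative corner `Δ ∈ (63/64, 1)` left open by the interval tables of `…KnnIntervalFull32`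
(prover seat `hubbard-h0-rotor-p1` g16)
-/

set_option linter.dupNamespace false
set_option autoImplicit false

namespace Summit.HubbardSuperconductivity.HubbardSuperconductivity.Theorems.AnisotropyChord.Knn
set_option maxHeartbeats 400000 in
/-- the ratio-majorant check passes at `η₀ = 1` for all `4 ≤ n ≤ 32`, `M + 4 ≤ n` (kernel evaluation; the worst Horner
value is `≈ 0.29 × budget`). [folklore] -/
theorem ratioCheckAll_one_4_32 : ratioCheckAll 1 4 32 = true := by decide +kernel

/-- (S_M) for all `4 ≤ n ≤ 32`, `M + 4 ≤ n` and EVERY real `0 < η ≤ 1`. [folklore] -/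
theorem budgetCondition_unit_of_le_32 {n M : ℕ} (hn : n ≤ 32) (hM : M + 4 ≤ n) {η : ℝ} (h0 : 0 < η) (h1 : η ≤ 1) :
    BudgetCondition n M η :=
  budgetCondition_of_ratioCheckAll ratioCheckAll_one_4_32 (by omega) hn hM h0 (by simpa using h1)

/-- **THEOREM (XY-Lieb–Mattis ordering on `K_{n,n}`, all `n ≤ 32`, all `0 ≤ Δ ≤ 1`, kernel-checked, corner closed):**
`⟨S⃗²⟩` of the sector ground states of the two-big-spin block `P_M(1−Δ)` is non-decreasing in `|Sᶻ_tot|` for every `n ≤ 32`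
and every real `Δ ∈ [0, 1]`.  `Δ = 1` is `xyLiebMattisKnn_one`; `Δ < 1` is the ratio-majorant check (`n ≥ 4`) or THEOREM Q
(`n ≤ 3`).  Not a statement about tori or the Hubbard model. [conjecture: theory seat hubbard-h0-rotor-theory-1, cycle 12 —
THEOREM Q⁺ decided family; Lean proof here] -/
theorem xyLiebMattisKnn_unit_of_le_32 {n : ℕ} (hn : n ≤ 32) {Δ : ℝ} (h0 : 0 ≤ Δ) (h1 : Δ ≤ 1) : XYLiebMattisKnn n Δ := by
  rcases eq_or_lt_of_le h1 with rfl | hlt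
  · exact xyLiebMattisKnn_one n
  by_cases h3 : n ≤ 3
  · exact xyLiebMattisKnn_of_le_three h3 hlt
  · exact xyLiebMattisKnn_of_ratioCheckAll ratioCheckAll_one_4_32 (by omega) hn hlt (by push_cast; linarith)

end Summit.HubbardSuperconductivity.HubbardSuperconductivity.Theorems.AnisotropyChord.Knn
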